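import Mathlib
import Literature.Geometry.Lorentzian.CauchyDevelopment
import Literature.Geometry.Lorentzian.Stationary
import Literature.Geometry.Lorentzian.LeviCivita
import HarnessLib

/-!
# KillingOrbitCompleteness

Topic `Literature/Geometry/Lorentzian`. Named literature fact (D-0014, `def … : Prop`, nothing is
proved or asserted; users take `(h : Chrusciel1993_thm_1_1)`).
Source: Chrusciel1993 — P. T. Chruściel, *On completeness of orbits of Killing vector fields*,
Class. Quantum Grav. **10** (1993) 2091–2101, doi:10.1088/0264-9381/10/10/016, arXiv:gr-qc/9304029.

* `Literature.Geometry.Lorentzian.Chrusciel1993_thm_1_1` — Thm. 1.1: in a smooth vacuum maximal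
  globally hyperbolic space-time with Killing field `X` and Cauchy surface `Σ`, the orbits of `X`
  are complete iff they exist for a uniform parameter time `ε > 0` through every point of `Σ`.
-/

namespace Literature.Geometry.Lorentzian

open Set Function
open scoped Manifold ContDiff Topology

/-- **Chruściel 1993, Theorem 1.1 (completeness of Killing orbits in maximal developments).**
"Let `(M,g)` be a smooth, vacuum, maximal globally hyperbolic space–time with Killing vector field
`X` and Cauchy surface `Σ`. The following conditions are equivalent: (i) There exists `ε > 0` such
that for all `p ∈ Σ` the orbits `φ_s(p)` of `X` through `p` are defined for all `s ∈ [−ε, ε]`.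
(ii) The orbits of `X` are complete in `M`."  Rendered over the tree's Cauchy-development vocabulary:
`(M,g)` is a vacuum Cauchy development `𝒟` of an initial data set `D` on a connected `3`-manifold
`X` which is maximal (`VacuumCauchyDevelopment.IsMaximal`, Choquet-Bruhat–Geroch), the Cauchy
surface is `ι(X) = range 𝒟.embed` (`CauchyDevelopment.isCauchyHypersurface`), `K` is a Killing
field of `𝒟.metric` (`LorentzianMetric.IsKillingField`: smooth with `𝓛_K g = 0`; standing
hypothesis `[g.HasLeviCivita]`), (i) is the existence, for one `ε > 0`, of an integral curve of
`K` on `[−ε, ε]` through every point of `range 𝒟.embed` (`IsMIntegralCurveOn`), and (ii) is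
`IsCompleteVectorField K` (every point lies on a whole-line integral curve).  The paper's
Corollary 1.2 (orbits complete in `D(Σ)` when `Σ` is compact, or asymptotically flat, or Cauchy
data for an asymptotically flat exterior region of a non-degenerate black hole) is NOT vendored
here: its case 3 needs the paper's §3 Definition D2 of a black-hole exterior data set.  Wanted by
route ZeroEnergyKerrOrBomb (dock `HawkingExtensionIsKerr`, statement item 17840 of that summit:
completeness of the extended Hawking field on the d.o.c. before Beig–Chruściel /
Chruściel–Costa–Heusler Thm. 3.2 apply) and recommended for vendoring in
`Cruxes/ZeroEnergyRigidity/Disproof.lean`.  A named fact (D-0014).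
[cite: Chrusciel1993, Thm. 1.1 (§1 Introduction; arXiv:gr-qc/9304029 p. 2)] -/
def Chrusciel1993_thm_1_1 : Prop :=
  ∀ (X : Type) [TopologicalSpace X] [ChartedSpace E3 X] [IsManifold (𝓡 3) ∞ X] [T2Space X]
    [SecondCountableTopology X] [ConnectedSpace X] (D : InitialDataSet (𝓡 3) X)
    (𝒟 : VacuumCauchyDevelopment D) [𝒟.metric.HasLeviCivita], 𝒟.IsMaximal →
    ∀ K : Π x : 𝒟.carrier, TangentSpace (𝓡 4) x, 𝒟.metric.IsKillingField K →
      ((∃ ε : ℝ, 0 < ε ∧ ∀ p ∈ range 𝒟.embed, ∃ γ : ℝ → 𝒟.carrier,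
          γ 0 = p ∧ IsMIntegralCurveOn γ K (Icc (-ε) ε)) ↔ IsCompleteVectorField K)

end Literature.Geometry.Lorentzian
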